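import Literature.AnabelianGeometry.EtaleTheta.SettingModelTateProp15iii
import Literature.AnabelianGeometry.EtaleTheta.Discharge.Sec1Prop15OfYCoordKit
import Literature.AnabelianGeometry.EtaleTheta.SettingModelTateOrigin
import Literature.AnabelianGeometry.EtaleTheta.SettingModelChiCyclotomes
import HarnessLib

/-!
# The STAGE-2 (Tate-sheared) χ-model of [EtTh] §1 (R78, row R270 census closer): the TRUTH TABLE of Prop. 1.5 —
# (i) ✓ (ii) ✓ (iii) ✓ at ONE étale-theta datum of `modelχq p 1 2` (vs. (i) ✓ (ii) ✓ (iii) ✗ at the split `modelχ`)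

S. Mochizuki, *The étale theta function and its Frobenioid-theoretic manifestations*, Publ. RIMS **45** (2009)
[EtTh], §1, Prop. 1.5 (i)(ii)(iii), PRIMS PDF p. 23 (printed 249) [cite: MochizukiEtTh2009, Prop 1.5 p.23].
Layer L2 of the abc-iut cell, R78 cluster STAGE 2, seat abc-iut-L2-t12 (gen 6), row R270 (abc-iut-L2-lead 11:30:50Z)
— its capstone instance was landed by abc-iut-L2-t6 (`SettingModelTateProp15iii`, `prop15iii_etaleThetaDataOfClass_etaDdχq_inr`);
this PROOF-ONLY file (0 definitions) records the JOINT census the row asked for: all three typed clauses of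
Prop. 1.5 hold TOGETHER at one datum — the étale-theta datum of the `z`-class `η̈♯ = etaDdχq` over the section Kummer
datum of `kummerCoreχq` along the Galois factor `inr`. Inputs BY NAME: abc-iut-L6-d5's kit assembly
`KummerCore.prop15i_and_prop15ii_ofSection_of_kit` (`Discharge/Sec1Prop15OfYCoordKit`) fed with abc-iut-w5-d171's F6q
`yCoordKitχq` (its classes ARE the core's `log(U)`, `log(Ü)`: `rfl`), abc-iut-L2-t6's `ŷ|_{Δ_Θ} = 0`
(`yThetaχq_eq_one_of_mem_deltaTheta`) and `z`-lift `zClassYχq` / `res_zClassYχq_eq_logTheta` (`SettingModelTateZClass`),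
abc-iut-L2-t6's unconditional Prop. 1.5 (iii) (`SettingModelTateDeckDisplayNegOne`, on this seat's gen-5 capstone
`KummerCore.prop15iii_etaleThetaDataOfClass_ofSection_of_generator`), abc-iut-w5-d051's `modelχq_isTateOrigin`.
(abc-iut-L6-d5's own (i) ∧ (ii) instance `prop15i_and_prop15ii_inrSection_modelχq`, p441623, is the same statement for
the (i)(ii) part; it is not imported here only because its parent olean is stranded at filing time — names kept disjoint.)

RESULTS:
* `prop15_i_ii_ofKit_inrSection_modelχq` — (i) ∧ (ii) at the `inr`-section datum, every `i`, every even `j`;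
* **`prop15_i_ii_iii_inrSection_modelχq`** — (i) ∧ (ii) ∧ (iii) at `(i, j) = (1, 2)` for the datum of `etaDdχq`;
* census `exists_etaleThetaData_prop15_all_modelχq` and the root form
  **`ThetaSetting.exists_isEtThOrigin_and_isTateOrigin_and_prop15_all`**: SOME theta setting satisfying the guard
  `IsEtThOrigin` AND the Tate clause `IsTateOrigin` carries an étale-theta datum `T` with
  `Prop15i T.toKummerData ∧ Prop15ii T.toKummerData ∧ Prop15iii T` (at `compat`). Contrast (stage 1, this seat's gen 5
  `SettingModelChiProp15iiiSplitNegative`): at the split `modelχ` (i) ✓ (ii) ✓ but (iii) ✗ for EVERY `η̈`.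
HONEST FRAMING: SEMI-SYNTHETIC model — consistency / non-vacuity evidence for the typed interface ONLY (joint
satisfiability of F-2502 ∧ F-2503 ∧ F-0591 with the §1 guard and the Tate clause); nothing of [EtTh] is asserted;
typed ≠ proved; no side is taken on [IUTchIII] Cor. 3.12.
-/

noncomputable section

namespace Literature.AnabelianGeometry.EtaleTheta.SettingModel

open Literature.AnabelianGeometry.SemiGraphs

variable (p : ℕ) [Fact p.Prime] (i j : ℤ) (hj : Even j)

/-- `inr(G_K) ≤ Π^tp_Y` at `modelχq` (degree `0`). [cite: MochizukiEtTh2009, §1 p.12] -/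
theorem map_inr_GK_le_GtpY_modelχq' :
    (ThetaSetting.modelχq p i j hj).GK.map (SemidirectProduct.inr : GQp p →* PiTpχq p i j) ≤
      (ThetaSetting.modelχq p i j hj).GtpY := by
  rintro _ ⟨σ, -, rfl⟩
  show (tateTwistData₀ p i j).toZ _ = 1
  rw [GfpTwistData₀.toZ_apply, SemidirectProduct.left_inr, map_one]

/-- `inr(G_K̈) ≤ Π^tp_Ÿ` at `modelχq` (`K̈ = ℚ_p`, trivial `Γ`-part). [cite: MochizukiEtTh2009, §1 p.17] -/
theorem map_inr_GKdd_le_GtpYdd_modelχq' :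
    (ThetaSetting.modelχq p i j hj).GKdd.map (SemidirectProduct.inr : GQp p →* PiTpχq p i j) ≤
      (ThetaSetting.modelχq p i j hj).GtpYdd := by
  rintro _ ⟨σ, -, rfl⟩
  refine mem_GtpYdd_modelχq_of_hHat_two_y p i j hj ?_ ?_
  · show (tateTwistData₀ p i j).toZ _ = 1
    rw [GfpTwistData₀.toZ_apply, SemidirectProduct.left_inr, map_one]
  · rw [SemidirectProduct.left_inr, map_one, map_one, Heis.one_y]

/-- **Prop. 1.5 (i) ∧ (ii) at the `inr`-section Kummer datum of `kummerCoreχq`** (every `i`, every even `j`): the kit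
`yCoordKitχq` supplies `log(U)`, `log(Ü)` on the nose, `ŷ` dies on `Δ_Θ`, and `zClassYχq` lifts `log(Θ)`.
[cite: MochizukiEtTh2009, Prop 1.5 (ii) p.23] -/
theorem prop15_i_ii_ofKit_inrSection_modelχq (hC : (ThetaSetting.modelχq p i j hj).Compat) :
    ThetaSetting.Prop15i ((kummerCoreχq p i j hj).toKummerDataOfSection SemidirectProduct.inr (continuous_inrχq p i j)
        (fun _ => rfl) (map_inr_GK_le_GtpY_modelχq' p i j hj) (map_inr_GKdd_le_GtpYdd_modelχq' p i j hj)) hC ∧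
      ThetaSetting.Prop15ii ((kummerCoreχq p i j hj).toKummerDataOfSection SemidirectProduct.inr (continuous_inrχq p i j)
        (fun _ => rfl) (map_inr_GK_le_GtpY_modelχq' p i j hj) (map_inr_GKdd_le_GtpYdd_modelχq' p i j hj)) hC :=
  haveI : T2Space (ThetaSetting.modelχq p i j hj).GtpTheta := CurveTheta.t2Space_GTheta (curveχq p i j)
  (kummerCoreχq p i j hj).prop15i_and_prop15ii_ofSection_of_kit (yCoordKitχq p i j hj) _ (continuous_inrχq p i j)
    (fun _ => rfl) (map_inr_GK_le_GtpY_modelχq' p i j hj) (map_inr_GKdd_le_GtpYdd_modelχq' p i j hj) hC rfl rfl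
    (fun _ hd => yThetaχq_eq_one_of_mem_deltaTheta p i j hd) (zClassYχq p i j hj)
    (res_zClassYχq_eq_logTheta p i j hj hC)

/-- **THE TRUTH TABLE AT STAGE 2: Prop. 1.5 (i) ∧ (ii) ∧ (iii) hold TOGETHER** at the étale-theta datum of `η̈♯ = etaDdχq`
over the `inr`-section Kummer datum of `modelχq p 1 2` ((iii) = abc-iut-L2-t6's unconditional instance on this seat's
capstone; (i)(ii) as above). [cite: MochizukiEtTh2009, Prop 1.5 p.23] -/
theorem prop15_i_ii_iii_inrSection_modelχq (hC : (ThetaSetting.modelχq p 1 2 even_two).Compat) :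
    ThetaSetting.Prop15i ((kummerCoreχq p 1 2 even_two).toKummerDataOfSection SemidirectProduct.inr
        (continuous_inrχq p 1 2) (fun _ => rfl) (map_inr_GK_le_GtpY_modelχq' p 1 2 even_two)
        (map_inr_GKdd_le_GtpYdd_modelχq' p 1 2 even_two)) hC ∧
      ThetaSetting.Prop15ii ((kummerCoreχq p 1 2 even_two).toKummerDataOfSection SemidirectProduct.inr
        (continuous_inrχq p 1 2) (fun _ => rfl) (map_inr_GK_le_GtpY_modelχq' p 1 2 even_two)
        (map_inr_GKdd_le_GtpYdd_modelχq' p 1 2 even_two)) hC ∧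
      ThetaSetting.Prop15iii (((kummerCoreχq p 1 2 even_two).toKummerDataOfSection SemidirectProduct.inr
        (continuous_inrχq p 1 2) (fun _ => rfl) (map_inr_GK_le_GtpY_modelχq' p 1 2 even_two)
        (map_inr_GKdd_le_GtpYdd_modelχq' p 1 2 even_two)).etaleThetaDataOfClass (etaDdχq p 1 2 even_two)) hC :=
  ⟨(prop15_i_ii_ofKit_inrSection_modelχq p 1 2 even_two hC).1, (prop15_i_ii_ofKit_inrSection_modelχq p 1 2 even_two hC).2,
    prop15iii_etaleThetaDataOfClass_etaDdχq p hC _ _ _ _ _⟩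

/-- **CENSUS (stage 2)**: `modelχq p 1 2` carries an étale-theta datum `T` with `T.etaDd = etaDdχq` whose Kummer data
satisfy Prop. 1.5 (i) ∧ (ii) and which satisfies Prop. 1.5 (iii) — for every `hC`. [cite: MochizukiEtTh2009, Prop 1.5 p.23] -/
theorem exists_etaleThetaData_prop15_all_modelχq (hC : (ThetaSetting.modelχq p 1 2 even_two).Compat) :
    ∃ T : (ThetaSetting.modelχq p 1 2 even_two).EtaleThetaData,
      T.etaDd = etaDdχq p 1 2 even_two ∧ ThetaSetting.Prop15i T.toKummerData hC ∧
        ThetaSetting.Prop15ii T.toKummerData hC ∧ ThetaSetting.Prop15iii T hC :=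
  ⟨((kummerCoreχq p 1 2 even_two).toKummerDataOfSection SemidirectProduct.inr
        (continuous_inrχq p 1 2) (fun _ => rfl) (map_inr_GK_le_GtpY_modelχq' p 1 2 even_two)
        (map_inr_GKdd_le_GtpYdd_modelχq' p 1 2 even_two)).etaleThetaDataOfClass (etaDdχq p 1 2 even_two),
    rfl, prop15_i_ii_iii_inrSection_modelχq p hC⟩

/-- **Root-level census form**: SOME theta setting satisfying the §1 guard `IsEtThOrigin` AND the Tate clause
`IsTateOrigin` carries an étale-theta datum on which ALL THREE typed clauses of Prop. 1.5 hold (at `compat`) — the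
typed Prop. 1.5 (F-2502 ∧ F-2503 ∧ F-0591) is jointly satisfiable together with the origin clauses; witness the
Tate-sheared model at the sign instance of record `(i, j) = (1, 2)` (the deck display of (iii) fixes `i = 1`, `j = 2`).
Contrast: at the split `modelχ` (stage 1) clause (iii) fails for every `η̈` (this seat, `not_prop15iii_etaleThetaDataχSec`).
[cite: MochizukiEtTh2009, Prop 1.5 p.23] -/
theorem _root_.Literature.AnabelianGeometry.EtaleTheta.ThetaSetting.exists_isEtThOrigin_and_isTateOrigin_and_prop15_all :
    ∃ D : ThetaSetting p, D.IsEtThOrigin ∧ D.IsTateOrigin ∧ ∃ T : D.EtaleThetaData,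
      ThetaSetting.Prop15i T.toKummerData D.compat ∧ ThetaSetting.Prop15ii T.toKummerData D.compat ∧
        ThetaSetting.Prop15iii T D.compat :=
  ⟨ThetaSetting.modelχq p 1 2 even_two, ThetaSetting.modelχq_isEtThOrigin p 1 2 even_two, modelχq_isTateOrigin p 1,
    ((kummerCoreχq p 1 2 even_two).toKummerDataOfSection SemidirectProduct.inr
        (continuous_inrχq p 1 2) (fun _ => rfl) (map_inr_GK_le_GtpY_modelχq' p 1 2 even_two)
        (map_inr_GKdd_le_GtpYdd_modelχq' p 1 2 even_two)).etaleThetaDataOfClass (etaDdχq p 1 2 even_two),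
    prop15_i_ii_iii_inrSection_modelχq p _⟩

end Literature.AnabelianGeometry.EtaleTheta.SettingModel

end
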